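import Mathlib
import Summits.Ventures.HodgeRepro2.Hypothesis
import Summits.Ventures.HodgeRepro2.CongruenceFiniteIndex

/-!
# Monotonicity of the irregularity bound, and its descent to principal congruence subgroups

`IrregularityAtLeast K τ₁ Q Γ k` (`Hypothesis.lean`) records `k` linearly independent
holomorphic 1-forms on the ball invariant under `realEmbedding K τ₁ Q γ` for all `γ ∈ Γ`;
`DR15Prop36Shape K τ₁ H Q 𝔠 𝔭𝔮` is the printed bound `≥ 3` for `Γ_1(𝔠) ∩ Γ_0(𝔭𝔮)`.

* `IrregularityAtLeast.anti`: the bound descends to smaller groups.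
* `IrregularityAtLeast.mono_k`: a bound `≥ k` gives `≥ k'` for `k' ≤ k`.
* `principalCongruence_inf_subset`: `Γ(𝔠 ⊓ 𝔭𝔮) ⊆ Γ_1(𝔠) ∩ Γ_0(𝔭𝔮)`
  (from `CongruenceFiniteIndex`).
* **`DR15Prop36Shape.irregularityAtLeast_principalCongruence`**: the printed bound descends to
  the principal congruence subgroup `Γ(𝔠 ⊓ 𝔭𝔮)`, a normal subgroup of finite index in `U(L)_𝓞`
  (`CongruenceFiniteIndex`); `DR15Prop36Shape.irregularityAtLeast_two`: two independent
  invariant holomorphic 1-forms on it.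

Everything is proved; no new axioms.
-/

namespace Summit.Ventures.HodgeRepro2.ShimuraData

section Monotone

variable {K : Type*} [Field K]

/-- The irregularity bound descends to smaller groups. -/
theorem IrregularityAtLeast.anti {τ₁ : K →+* ℂ} {Q : Matrix (Fin 3) (Fin 3) ℂ}
    {Γ Γ' : Set (GL (Fin 3) K)} (hΓ : Γ' ⊆ Γ) {k : ℕ} (h : IrregularityAtLeast K τ₁ Q Γ k) :
    IrregularityAtLeast K τ₁ Q Γ' k := by
  obtain ⟨q, hq, hqi⟩ := h
  exact ⟨q, hq, fun i => ⟨(hqi i).1, fun γ hγ => (hqi i).2 γ (hΓ hγ)⟩⟩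

/-- A bound `≥ k` gives a bound `≥ k'` for `k' ≤ k` (restrict the family). -/
theorem IrregularityAtLeast.mono_k {τ₁ : K →+* ℂ} {Q : Matrix (Fin 3) (Fin 3) ℂ}
    {Γ : Set (GL (Fin 3) K)} {k k' : ℕ} (hk : k' ≤ k) (h : IrregularityAtLeast K τ₁ Q Γ k) :
    IrregularityAtLeast K τ₁ Q Γ k' := by
  obtain ⟨q, hq, hqi⟩ := h
  exact ⟨q ∘ Fin.castLE hk, hq.comp _ (Fin.castLE_injective hk), fun i => hqi _⟩

/-- The bound `≥ 0` is vacuous. -/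
theorem irregularityAtLeast_zero (τ₁ : K →+* ℂ) (Q : Matrix (Fin 3) (Fin 3) ℂ)
    (Γ : Set (GL (Fin 3) K)) : IrregularityAtLeast K τ₁ Q Γ 0 :=
  ⟨fun i => Fin.elim0 i, linearIndependent_empty_type, fun i => Fin.elim0 i⟩

end Monotone

section Descent

open NumberField

variable {K : Type*} [Field K] [NumberField K] [NumberField.IsCMField K]

/-- `Γ(𝔠 ⊓ 𝔭𝔮) ⊆ Γ_1(𝔠) ∩ Γ_0(𝔭𝔮)`. -/
theorem principalCongruence_inf_subset (H : Matrix (Fin 3) (Fin 3) K) (𝔠 𝔭𝔮 : Ideal (𝓞 K)) :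
    principalCongruence K H (𝔠 ⊓ 𝔭𝔮) ⊆ congruence₁ K H 𝔠 ∩ congruence₀ K H 𝔭𝔮 := by
  intro γ hγ
  refine ⟨principalCongruence_subset_congruence₁ H 𝔠
    (principalCongruence_subset_of_le H _ inf_le_left hγ),
    principalCongruence_subset_congruence₀ H 𝔭𝔮
    (principalCongruence_subset_of_le H _ inf_le_right hγ)⟩

/-- **The DR15 irregularity bound descends to the principal congruence subgroup**
`Γ(𝔠 ⊓ 𝔭𝔮)`, a normal subgroup of finite index in `U(L)_𝓞`. -/
theorem DR15Prop36Shape.irregularityAtLeast_principalCongruence {τ₁ : K →+* ℂ}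
    {H : Matrix (Fin 3) (Fin 3) K} {Q : Matrix (Fin 3) (Fin 3) ℂ} {𝔠 𝔭𝔮 : Ideal (𝓞 K)}
    (h : DR15Prop36Shape K τ₁ H Q 𝔠 𝔭𝔮) :
    IrregularityAtLeast K τ₁ Q (principalCongruence K H (𝔠 ⊓ 𝔭𝔮)) 3 :=
  IrregularityAtLeast.anti (principalCongruence_inf_subset H 𝔠 𝔭𝔮) h

/-- Two independent invariant holomorphic 1-forms on `Γ(𝔠 ⊓ 𝔭𝔮)`. -/
theorem DR15Prop36Shape.irregularityAtLeast_two {τ₁ : K →+* ℂ} {H : Matrix (Fin 3) (Fin 3) K}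
    {Q : Matrix (Fin 3) (Fin 3) ℂ} {𝔠 𝔭𝔮 : Ideal (𝓞 K)} (h : DR15Prop36Shape K τ₁ H Q 𝔠 𝔭𝔮) :
    IrregularityAtLeast K τ₁ Q (principalCongruence K H (𝔠 ⊓ 𝔭𝔮)) 2 :=
  IrregularityAtLeast.mono_k (by norm_num) h.irregularityAtLeast_principalCongruence

end Descent

end Summit.Ventures.HodgeRepro2.ShimuraData
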